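import Mathlib
import Literature.AlgebraicGeometry.Tropical.TorusCycles
import Summits.HodgeConjecture.HodgeConjecture.Theorems.TropicalWeilSupply.Negative.FalseOfTropicalWeilVanishing
import HarnessLib

/-!
# Crux `TropicalWeilVanishing` (stmt-HodgeConjecture-18478), line `identity_transfer`, stub
# `stub_rung_flatObstructed` — the linear-algebra end: an obstruction functional from ONE
# type-forced lattice vector

Route `TropicalWeilObstruction` of `HodgeConjecture`. The registered stub `stub_rung_flatObstructed`
("a FLAT effective tropical `4`-cycle `Z₀` on `ℝ⁸/ℤ⁸` with `W(Z₀) ≠ 0` is obstructed at the identity")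
ends with a piece of plain linear algebra, isolated and proved here for every `n` (the stub is
`n = 4`). Write `J = weilJ n` (`J² = -1`; `Jᵀ = -J` is the tree's
`TropicalWeilSupply.Negative.weilJ_transpose`), `L` for the common (integer, `2n × n`) frame of the
cells, `M = L·ℝⁿ ⊂ ℝ²ⁿ` for its real column span and `η(L) = frameComplexDet n L`.

* `weilJ_mul_weilJ`, `weilJ_mulVec_weilJ_mulVec`, `dotProduct_weilJ_mulVec_self` — `J² = -1`, `v·Jv = 0`.
* `frame_totallyReal` — **`η(L) ≠ 0` makes `M` totally real**: `L x = J (L y)` forces `x = y = 0`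
  (read `L x + i·L y`-type combinations through the complex `n × n` matrix
  `C = (L_{kj} + i L_{k+n,j})`, `det C = η(L) ≠ 0`: `C (x - i y) = 0`).
* `weilSymm_pair_transpose`, `weilSymm_pair_comm` — for vectors `a, b` the matrix
  `D(a,b) = a bᵀ + b aᵀ + (Ja)(Jb)ᵀ + (Jb)(Ja)ᵀ` is symmetric and commutes with `J`
  (the realification of the Hermitian matrix `u v* + v u*`).
* `exists_obstruction_of_constraint` — **THE OBSTRUCTION**: if `η(L) ≠ 0`, `2 ≤ n`, and
  `κ ∈ M`, `κ ≠ 0`, then there is a linear functional `ℓ` on `2n × 2n` real matrices with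
  `ℓ D ≠ 0` for some symmetric `J`-commuting `D` and `ℓ Q' = 0` for every `Q'` with `Q' κ ∈ M`.
  Proof: pick `m' ∈ M`, `m' ≠ 0`, `m' · κ = 0` (`dim M = n ≥ 2`); `D := D(κ, J m')` has
  `D κ = (Jm'·κ) κ + |κ|² J m' ∉ M` (else `J m' ∈ M ∩ J M = 0`); take `ℓ` killing the subspace
  `{Q' | Q' κ ∈ M}` and not `D` (`Submodule.exists_dual_map_eq_bot_of_notMem`).

In the stub, `κ` is the facet-shift sum of a closed incidence chain of the flat cycle: every
realisation `Q'` of the combinatorial type satisfies `Q' κ ∈ M_ℝ`, so `ℓ` vanishes on all realisable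
symmetric `J`-commuting periods — i.e. `ObstructedAtIdentity Z₀`. Mathlib-only linear algebra; no
definition, no named fact, no sorry.
-/

-- `Summit.HodgeConjecture.HodgeConjecture.…` is the mandated namespace (single-conjunct summit).
set_option linter.dupNamespace false

noncomputable section

open scoped BigOperators Matrix
open Matrix Literature.AlgebraicGeometry.Tropical

namespace Summit.HodgeConjecture.HodgeConjecture.Theorems.TropicalWeilVanishing

variable {n : ℕ}

/-! ### The complex structure `J = weilJ n` -/

/-- `(J v)_k = - v_{k+n}` for `k < n`. [cite: Zharkov2020TropicalWeil, §2 (pp. 2–4)] -/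
theorem weilJ_mulVec_apply_lo (v : Fin (2 * n) → ℝ) (k : Fin n) :
    (weilJ n *ᵥ v) ⟨(k : ℕ), by omega⟩ = - v ⟨(k : ℕ) + n, by omega⟩ := by
  rw [Matrix.mulVec, dotProduct, Finset.sum_eq_single ⟨(k : ℕ) + n, by omega⟩]
  · have h1 : ¬ ((k : ℕ) = (k : ℕ) + n + n) := by omega
    simp [weilJ, h1]
  · intro b _ hb
    have hb' : ¬ ((b : ℕ) = (k : ℕ) + n) := fun h => hb (Fin.ext h)
    simp only [weilJ]
    rw [if_neg (by omega), if_neg hb', zero_mul]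
  · intro h; exact absurd (Finset.mem_univ _) h

/-- `(J v)_{k+n} = v_k` for `k < n`. [cite: Zharkov2020TropicalWeil, §2 (pp. 2–4)] -/
theorem weilJ_mulVec_apply_hi (v : Fin (2 * n) → ℝ) (k : Fin n) :
    (weilJ n *ᵥ v) ⟨(k : ℕ) + n, by omega⟩ = v ⟨(k : ℕ), by omega⟩ := by
  rw [Matrix.mulVec, dotProduct, Finset.sum_eq_single ⟨(k : ℕ), by omega⟩]
  · simp [weilJ]
  · intro b _ hb
    have hb' : ¬ ((k : ℕ) + n = (b : ℕ) + n) := fun h => hb (Fin.ext (by simpa using h.symm))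
    simp only [weilJ]
    rw [if_neg hb', if_neg (by omega), zero_mul]
  · intro h; exact absurd (Finset.mem_univ _) h

/-- Every index of `Fin (2n)` is `k` or `k + n` for some `k < n`. [folklore] -/
theorem fin_two_mul_cases (a : Fin (2 * n)) :
    (∃ k : Fin n, a = ⟨(k : ℕ), by omega⟩) ∨ ∃ k : Fin n, a = ⟨(k : ℕ) + n, by omega⟩ := by
  by_cases h : (a : ℕ) < n
  · exact Or.inl ⟨⟨a, h⟩, Fin.ext rfl⟩
  · refine Or.inr ⟨⟨(a : ℕ) - n, by omega⟩, Fin.ext ?_⟩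
    simp only
    omega

/-- `J (J v) = -v`. [cite: Zharkov2020TropicalWeil, §2 (pp. 2–4)] -/
theorem weilJ_mulVec_weilJ_mulVec (v : Fin (2 * n) → ℝ) :
    weilJ n *ᵥ (weilJ n *ᵥ v) = -v := by
  ext a
  rcases fin_two_mul_cases a with ⟨k, rfl⟩ | ⟨k, rfl⟩
  · rw [weilJ_mulVec_apply_lo, weilJ_mulVec_apply_hi, Pi.neg_apply]
  · rw [weilJ_mulVec_apply_hi, weilJ_mulVec_apply_lo, Pi.neg_apply]

/-- `J² = -1`. [cite: Zharkov2020TropicalWeil, §2 (pp. 2–4)] -/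
theorem weilJ_mul_weilJ (n : ℕ) : weilJ n * weilJ n = -1 := by
  apply (Matrix.toLin' (R := ℝ)).injective
  apply LinearMap.ext
  intro v
  rw [Matrix.toLin'_apply, Matrix.toLin'_apply, ← Matrix.mulVec_mulVec, weilJ_mulVec_weilJ_mulVec,
    Matrix.neg_mulVec, Matrix.one_mulVec]

/-- `v ᵥ* J = -(J v)` (row action of the antisymmetric `J`). [folklore] -/
theorem vecMul_weilJ (v : Fin (2 * n) → ℝ) : v ᵥ* weilJ n = -(weilJ n *ᵥ v) := by
  rw [← Matrix.mulVec_transpose, TropicalWeilSupply.Negative.weilJ_transpose, Matrix.neg_mulVec]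

/-- `v · (J v) = 0`. [folklore] -/
theorem dotProduct_weilJ_mulVec_self (v : Fin (2 * n) → ℝ) : v ⬝ᵥ (weilJ n *ᵥ v) = 0 := by
  have h : v ⬝ᵥ (weilJ n *ᵥ v) = -(v ⬝ᵥ (weilJ n *ᵥ v)) := by
    conv_lhs => rw [Matrix.dotProduct_mulVec, vecMul_weilJ, neg_dotProduct,
      dotProduct_comm]
  linarith

/-- `(J a) · (J b) = a · b` (`J` is orthogonal). [folklore] -/
theorem weilJ_mulVec_dotProduct_weilJ_mulVec (a b : Fin (2 * n) → ℝ) :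
    (weilJ n *ᵥ a) ⬝ᵥ (weilJ n *ᵥ b) = a ⬝ᵥ b := by
  rw [Matrix.dotProduct_mulVec, vecMul_weilJ, neg_dotProduct, weilJ_mulVec_weilJ_mulVec,
    neg_dotProduct, neg_neg]

/-- `(J a) · b = -(a · J b)`. [folklore] -/
theorem weilJ_mulVec_dotProduct (a b : Fin (2 * n) → ℝ) :
    (weilJ n *ᵥ a) ⬝ᵥ b = -(a ⬝ᵥ (weilJ n *ᵥ b)) := by
  rw [dotProduct_comm, Matrix.dotProduct_mulVec, vecMul_weilJ, neg_dotProduct,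
    dotProduct_comm]

/-! ### `η(L) ≠ 0` makes the frame span totally real -/

/-- **Totally real frames.** If `η(L) = frameComplexDet n L ≠ 0` then `M = L·ℝⁿ` meets `J M` only in
`0`, in the strong form `L x = J (L y) ⟹ x = 0 ∧ y = 0`: with `C = (L_{kj} + i L_{k+n,j})_{k,j}`
(`det C = η(L)`), the two halves of `L x = J (L y)` say `C (x - i y) = 0`.
[cite: Zharkov2020TropicalWeil, §2 (pp. 2–4)] -/
theorem frame_totallyReal (L : Matrix (Fin (2 * n)) (Fin n) ℤ) (hL : frameComplexDet n L ≠ 0)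
    (x y : Fin n → ℝ)
    (h : L.map ((↑) : ℤ → ℝ) *ᵥ x = weilJ n *ᵥ (L.map ((↑) : ℤ → ℝ) *ᵥ y)) : x = 0 ∧ y = 0 := by
  set C : Matrix (Fin n) (Fin n) ℂ := Matrix.of fun k j : Fin n =>
    ((L ⟨(k : ℕ), by omega⟩ j : ℤ) : ℂ) + ((L ⟨(k : ℕ) + n, by omega⟩ j : ℤ) : ℂ) * Complex.I with hC
  have hdet : C.det ≠ 0 := hL
  set z : Fin n → ℂ := fun j => ((x j : ℝ) : ℂ) - Complex.I * ((y j : ℝ) : ℂ) with hz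
  -- the two halves of `L x = J (L y)`
  have hlo : ∀ k : Fin n, ∑ j, (L ⟨(k : ℕ), by omega⟩ j : ℝ) * x j =
      -∑ j, (L ⟨(k : ℕ) + n, by omega⟩ j : ℝ) * y j := by
    intro k
    have := congrFun h ⟨(k : ℕ), by omega⟩
    rw [weilJ_mulVec_apply_lo] at this
    simpa [Matrix.mulVec, dotProduct, Matrix.map_apply] using this
  have hhi : ∀ k : Fin n, ∑ j, (L ⟨(k : ℕ) + n, by omega⟩ j : ℝ) * x j =
      ∑ j, (L ⟨(k : ℕ), by omega⟩ j : ℝ) * y j := by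
    intro k
    have := congrFun h ⟨(k : ℕ) + n, by omega⟩
    rw [weilJ_mulVec_apply_hi] at this
    simpa [Matrix.mulVec, dotProduct, Matrix.map_apply] using this
  have hCz : C *ᵥ z = 0 := by
    ext k
    simp only [Matrix.mulVec, dotProduct, hC, hz, Matrix.of_apply, Pi.zero_apply]
    have e1 := congrArg (fun r : ℝ => (r : ℂ)) (hlo k)
    have e2 := congrArg (fun r : ℝ => (r : ℂ)) (hhi k)
    simp only [Complex.ofReal_sum, Complex.ofReal_mul, Complex.ofReal_neg, Complex.ofReal_intCast] at e1 e2
    have : ∑ j, (((L ⟨(k : ℕ), by omega⟩ j : ℤ) : ℂ) + ((L ⟨(k : ℕ) + n, by omega⟩ j : ℤ) : ℂ) * Complex.I) *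
        (((x j : ℝ) : ℂ) - Complex.I * ((y j : ℝ) : ℂ)) =
        (∑ j, ((L ⟨(k : ℕ), by omega⟩ j : ℤ) : ℂ) * ((x j : ℝ) : ℂ) +
          ∑ j, ((L ⟨(k : ℕ) + n, by omega⟩ j : ℤ) : ℂ) * ((y j : ℝ) : ℂ)) +
        Complex.I * (∑ j, ((L ⟨(k : ℕ) + n, by omega⟩ j : ℤ) : ℂ) * ((x j : ℝ) : ℂ) -
          ∑ j, ((L ⟨(k : ℕ), by omega⟩ j : ℤ) : ℂ) * ((y j : ℝ) : ℂ)) := by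
      rw [← Finset.sum_add_distrib, ← Finset.sum_sub_distrib, Finset.mul_sum, ← Finset.sum_add_distrib]
      refine Finset.sum_congr rfl fun j _ => ?_
      have hI : Complex.I * Complex.I = -1 := Complex.I_mul_I
      linear_combination (-((L ⟨(k : ℕ) + n, by omega⟩ j : ℤ) : ℂ) * ((y j : ℝ) : ℂ)) * hI
    rw [this, e1, e2, neg_add_cancel, sub_self, mul_zero, add_zero]
  have hz0 : z = 0 := Matrix.eq_zero_of_mulVec_eq_zero hdet hCz
  constructor
  · ext j
    have := congrFun hz0 j
    simp only [hz, Pi.zero_apply] at this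
    have hre := congrArg Complex.re this
    simpa using hre
  · ext j
    have := congrFun hz0 j
    simp only [hz, Pi.zero_apply] at this
    have him := congrArg Complex.im this
    simpa using him

/-- Injectivity of a frame with `η(L) ≠ 0` (the case `y = 0` of `frame_totallyReal`). [folklore] -/
theorem frame_mulVec_injective (L : Matrix (Fin (2 * n)) (Fin n) ℤ) (hL : frameComplexDet n L ≠ 0) :
    Function.Injective fun x : Fin n → ℝ => L.map ((↑) : ℤ → ℝ) *ᵥ x := by
  intro x x' hxx'
  have h : L.map ((↑) : ℤ → ℝ) *ᵥ (x - x') = weilJ n *ᵥ (L.map ((↑) : ℤ → ℝ) *ᵥ (0 : Fin n → ℝ)) := by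
    rw [Matrix.mulVec_sub, Matrix.mulVec_zero, Matrix.mulVec_zero, sub_eq_zero]
    exact hxx'
  exact sub_eq_zero.mp (frame_totallyReal L hL _ _ h).1

/-! ### Symmetric `J`-commuting rank-`≤ 4` matrices -/

/-- `D(a,b) = a bᵀ + b aᵀ + (Ja)(Jb)ᵀ + (Jb)(Ja)ᵀ` is symmetric. [folklore] -/
theorem weilSymm_pair_transpose (a b : Fin (2 * n) → ℝ) :
    (vecMulVec a b + vecMulVec b a + vecMulVec (weilJ n *ᵥ a) (weilJ n *ᵥ b) +
        vecMulVec (weilJ n *ᵥ b) (weilJ n *ᵥ a))ᵀ =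
      vecMulVec a b + vecMulVec b a + vecMulVec (weilJ n *ᵥ a) (weilJ n *ᵥ b) +
        vecMulVec (weilJ n *ᵥ b) (weilJ n *ᵥ a) := by
  simp only [Matrix.transpose_add, Matrix.transpose_vecMulVec]
  abel

/-- `D(a,b)` commutes with `J` (`J (x yᵀ) = (Jx) yᵀ`, `(x yᵀ) J = -x (Jy)ᵀ`, `J² = -1`). [folklore] -/
theorem weilSymm_pair_comm (a b : Fin (2 * n) → ℝ) :
    (vecMulVec a b + vecMulVec b a + vecMulVec (weilJ n *ᵥ a) (weilJ n *ᵥ b) +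
        vecMulVec (weilJ n *ᵥ b) (weilJ n *ᵥ a)) * weilJ n =
      weilJ n * (vecMulVec a b + vecMulVec b a + vecMulVec (weilJ n *ᵥ a) (weilJ n *ᵥ b) +
        vecMulVec (weilJ n *ᵥ b) (weilJ n *ᵥ a)) := by
  simp only [Matrix.add_mul, Matrix.mul_add, Matrix.vecMulVec_mul, Matrix.mul_vecMulVec, vecMul_weilJ,
    weilJ_mulVec_weilJ_mulVec, Matrix.vecMulVec_neg, Matrix.neg_vecMulVec, neg_neg]
  abel

/-- `D(a,b) v = (b·v) a + (a·v) b + (Jb·v) Ja + (Ja·v) Jb`. [folklore] -/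
theorem weilSymm_pair_mulVec (a b v : Fin (2 * n) → ℝ) :
    (vecMulVec a b + vecMulVec b a + vecMulVec (weilJ n *ᵥ a) (weilJ n *ᵥ b) +
        vecMulVec (weilJ n *ᵥ b) (weilJ n *ᵥ a)) *ᵥ v =
      (b ⬝ᵥ v) • a + (a ⬝ᵥ v) • b + ((weilJ n *ᵥ b) ⬝ᵥ v) • (weilJ n *ᵥ a) +
        ((weilJ n *ᵥ a) ⬝ᵥ v) • (weilJ n *ᵥ b) := by
  simp only [Matrix.add_mulVec, Matrix.vecMulVec_mulVec]
  ext i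
  simp [Pi.add_apply, Pi.smul_apply, smul_eq_mul, mul_comm]

/-! ### The obstruction functional -/

/-- **Obstruction from one type-forced lattice vector.** Let `L` be a `2n × n` integer frame with
`η(L) = frameComplexDet n L ≠ 0` (`M = L·ℝⁿ` totally real), `n ≥ 2`, and `κ ∈ M`, `κ ≠ 0`. Then there
is a linear functional `ℓ` on real `2n × 2n` matrices which does not vanish at some symmetric matrix
commuting with `J = weilJ n`, yet vanishes at every `Q'` with `Q' κ ∈ M`. (With
`m' ∈ M ∖ 0`, `m'·κ = 0`: `D = D(κ, Jm')` has `D κ = (Jm'·κ) κ + |κ|² Jm' ∉ M`, and `ℓ` separates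
`D` from the subspace `{Q' | Q' κ ∈ M}`.) [cite: Zharkov2020TropicalWeil, §1–2 (pp. 2–4)] -/
theorem exists_obstruction_of_constraint (hn : 2 ≤ n) (L : Matrix (Fin (2 * n)) (Fin n) ℤ)
    (hL : frameComplexDet n L ≠ 0) (κ : Fin (2 * n) → ℝ)
    (hκM : κ ∈ LinearMap.range (L.map ((↑) : ℤ → ℝ)).mulVecLin) (hκ : κ ≠ 0) :
    ∃ ℓ : Matrix (Fin (2 * n)) (Fin (2 * n)) ℝ →ₗ[ℝ] ℝ,
      (∃ D : Matrix (Fin (2 * n)) (Fin (2 * n)) ℝ, D.IsSymm ∧ D * weilJ n = weilJ n * D ∧ ℓ D ≠ 0) ∧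
      ∀ Q' : Matrix (Fin (2 * n)) (Fin (2 * n)) ℝ,
        Q' *ᵥ κ ∈ LinearMap.range (L.map ((↑) : ℤ → ℝ)).mulVecLin → ℓ Q' = 0 := by
  classical
  set Lr : Matrix (Fin (2 * n)) (Fin n) ℝ := L.map ((↑) : ℤ → ℝ) with hLr
  set M : Submodule ℝ (Fin (2 * n) → ℝ) := LinearMap.range Lr.mulVecLin with hM
  have hinj : Function.Injective fun x : Fin n → ℝ => Lr *ᵥ x := frame_mulVec_injective L hL
  -- `J M ∩ M = 0`
  have htr : ∀ m ∈ M, weilJ n *ᵥ m ∈ M → m = 0 := by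
    rintro m ⟨y, rfl⟩ ⟨x, hx⟩
    simp only [Matrix.mulVecLin_apply] at hx ⊢
    have := (frame_totallyReal L hL x y hx).2
    rw [this, Matrix.mulVec_zero]
  -- two independent vectors of `M`
  let i₀ : Fin n := ⟨0, by omega⟩
  let i₁ : Fin n := ⟨1, by omega⟩
  set m₁ : Fin (2 * n) → ℝ := Lr *ᵥ Pi.single i₀ 1 with hm₁
  set m₂ : Fin (2 * n) → ℝ := Lr *ᵥ Pi.single i₁ 1 with hm₂
  have hm₁M : m₁ ∈ M := ⟨Pi.single i₀ 1, rfl⟩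
  have hm₂M : m₂ ∈ M := ⟨Pi.single i₁ 1, rfl⟩
  have hind : ∀ s t : ℝ, s • m₁ + t • m₂ = 0 → s = 0 ∧ t = 0 := by
    intro s t hst
    have h0 : Lr *ᵥ (s • Pi.single i₀ 1 + t • Pi.single i₁ 1) = Lr *ᵥ 0 := by
      rw [Matrix.mulVec_add, Matrix.mulVec_smul, Matrix.mulVec_smul, Matrix.mulVec_zero]
      exact hst
    have h1 := hinj h0
    have hs := congrFun h1 i₀
    have ht := congrFun h1 i₁
    have hne : i₀ ≠ i₁ := by simp [i₀, i₁, Fin.ext_iff]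
    simp [hne, hne.symm] at hs ht
    exact ⟨hs, ht⟩
  -- a non-zero `m' ∈ M` orthogonal to `κ`
  obtain ⟨m', hm'M, hm'0, hm'κ⟩ : ∃ m' ∈ M, m' ≠ 0 ∧ m' ⬝ᵥ κ = 0 := by
    by_cases h1 : m₁ ⬝ᵥ κ = 0
    · refine ⟨m₁, hm₁M, fun h => ?_, h1⟩
      have := (hind 1 0 (by rw [h, one_smul, zero_smul, add_zero])).1
      exact one_ne_zero this
    · refine ⟨(m₂ ⬝ᵥ κ) • m₁ + (-(m₁ ⬝ᵥ κ)) • m₂, M.add_mem (M.smul_mem _ hm₁M) (M.smul_mem _ hm₂M),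
        fun h => h1 (neg_eq_zero.mp (hind _ _ h).2), ?_⟩
      rw [add_dotProduct, smul_dotProduct, smul_dotProduct, smul_eq_mul, smul_eq_mul]
      ring
  -- the matrix `D = D(κ, J m')`
  set b : Fin (2 * n) → ℝ := weilJ n *ᵥ m' with hb
  set D : Matrix (Fin (2 * n)) (Fin (2 * n)) ℝ :=
    vecMulVec κ b + vecMulVec b κ + vecMulVec (weilJ n *ᵥ κ) (weilJ n *ᵥ b) +
      vecMulVec (weilJ n *ᵥ b) (weilJ n *ᵥ κ) with hD
  have hDsymm : D.IsSymm := weilSymm_pair_transpose κ b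
  have hDJ : D * weilJ n = weilJ n * D := weilSymm_pair_comm κ b
  have hJb : weilJ n *ᵥ b = -m' := by rw [hb, weilJ_mulVec_weilJ_mulVec]
  have hJκκ : (weilJ n *ᵥ κ) ⬝ᵥ κ = 0 := by
    rw [weilJ_mulVec_dotProduct, dotProduct_weilJ_mulVec_self, neg_zero]
  have hDκ : D *ᵥ κ = (b ⬝ᵥ κ) • κ + (κ ⬝ᵥ κ) • b := by
    rw [hD, weilSymm_pair_mulVec, hJb, neg_dotProduct, hm'κ, neg_zero, zero_smul, add_zero, hJκκ,
      zero_smul, add_zero]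
  -- `D κ ∉ M`
  set A : Submodule ℝ (Matrix (Fin (2 * n)) (Fin (2 * n)) ℝ) :=
    M.comap ((LinearMap.applyₗ κ).comp (Matrix.toLin' (R := ℝ) (m := Fin (2 * n))
      (n := Fin (2 * n))).toLinearMap) with hA
  have hAmem : ∀ Q' : Matrix (Fin (2 * n)) (Fin (2 * n)) ℝ, Q' ∈ A ↔ Q' *ᵥ κ ∈ M := by
    intro Q'
    simp [hA, Matrix.toLin'_apply]
  have hκκ : κ ⬝ᵥ κ ≠ 0 := fun h => hκ (dotProduct_self_eq_zero.mp h)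
  have hDA : D ∉ A := by
    intro hDA'
    rw [hAmem, hDκ] at hDA'
    have h1 : (κ ⬝ᵥ κ) • b ∈ M := by
      have := M.sub_mem hDA' (M.smul_mem (b ⬝ᵥ κ) hκM)
      rwa [add_sub_cancel_left] at this
    have h2 : b ∈ M := by
      have := M.smul_mem (κ ⬝ᵥ κ)⁻¹ h1
      rwa [smul_smul, inv_mul_cancel₀ hκκ, one_smul] at this
    have h3 : m' = 0 := htr m' hm'M (by rw [← hb]; exact h2)
    exact hm'0 h3
  obtain ⟨ℓ, hℓD, hℓA⟩ := Submodule.exists_dual_map_eq_bot_of_notMem hDA inferInstance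
  refine ⟨ℓ, ⟨D, hDsymm, hDJ, hℓD⟩, fun Q' hQ' => ?_⟩
  have hQ'A : Q' ∈ A := (hAmem Q').2 hQ'
  have : ℓ Q' ∈ A.map ℓ := Submodule.mem_map_of_mem hQ'A
  rw [hℓA] at this
  simpa using this

end Summit.HodgeConjecture.HodgeConjecture.Theorems.TropicalWeilVanishing

end
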